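import Mathlib
import HarnessLib
import Summits.NavierStokesRegularity.NavierStokesRegularity.Theorems.PoloidalWindowDoorLrcModEntireSheetSystemUniqueness

/-!
# Route `PoloidalWindowDoor`, item `LrcModEntire` (stmt-NavierStokesRegularity-20428), cell (Q4-sonic, straight branch, μ(−1,0) < 0), case I —
# CAUCHY–KOVALEVSKAYA RECURSION FOR THE MIXED SYSTEM (one second-order, two first-order unknowns): brick B-CK2′ of T2B-g17 §7 (7′)

Cell ns-regularity-ideate, LEAD-lineage seat ns-poloidal-K2-p3 g17 (`--supports stmt-NavierStokesRegularity-20428`).  Class-free companion of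
`…SheetSystemUniqueness` (p738468): the same normal-jet toolkit on the tube `O × ℝ` in `Y × ℝ`, now for the system that the case-I kill actually meets once the
horizontal potential is eliminated — unknowns `(g, P, Q) := (∂_eU₂, ⟪∂_eU_h, e⟫, ⟪∂_eU_h, Je⟫)`, all explicit derivatives of the profile:
(curl) `∂_mP = ∂_sQ`, (div) `∂_mQ = −∂_sP − (∂_z − d_z∂_m)g`, (E3) `∂_m²g = …` (p530500 along `e`).

* `vanishesToOrder_all_of_mixedSystem` — if «`g` to order `k+1`, `P, Q` to order `k` ⇒ `∂_m²g, ∂_mP, ∂_mQ` to order `k`» and `g, ∂_mg, P, Q` vanish on the sheet,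
  then all normal jets vanish;
* `eq_zero_on_tube_of_mixedSystem` — if moreover `g` is real-analytic along normal lines, `g ≡ 0` on the tube (only `g` needs analyticity);
* `eq_zero_of_mixedSystem_template` — **the template of the application**: the three rows (curl)/(div)/(E3) with arbitrary smooth coefficients and zero data ⊢ `g ≡ 0`
  (the recursion hypothesis is discharged by the toolkit of p738468 — this is what the assembly A-I invokes).

WHAT THIS IS NOT: not a claim about Navier–Stokes regularity and not a stub of the registry; class-free calculus for the residual research cell `stub_Q4sonicLineNeg`
of `Cruxes/LrcModEntire/Lines/twist_split.lean` v13 (bears_on LADDER-NS N0 via item 20428).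
-/

noncomputable section

set_option linter.dupNamespace false

namespace Summit.NavierStokesRegularity.NavierStokesRegularity.Theorems.PoloidalWindowDoorLrcModEntireSheetSystemMixed

open Set Function Filter Topology
open scoped ContDiff
open Summit.NavierStokesRegularity.NavierStokesRegularity.Theorems.PoloidalWindowDoorLrcModEntireSheetSystemUniqueness

variable {Y : Type*} [NormedAddCommGroup Y] [NormedSpace ℝ Y]

/-! ### The mixed system — one second-order unknown `g` and two first-order unknowns `P, Q`

In the application `g = ∂_eU₂` and `(P, Q) = (⟪∂_eU_h, e⟫, ⟪∂_eU_h, Je⟫)` are explicit derivatives of the profile (no horizontal potential is needed): the horizontal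
curl and divergence identities give `∂_mP = ∂_sQ` and `∂_mQ = −∂_sP − (∂_z − d_z∂_m)g`, first order in the normal direction, while (E3) gives `∂_m²g` in terms of
`g, ∂g, P, Q`.  The recursion below is the corresponding Cauchy–Kovalevskaya induction; the Cauchy data are `g, ∂_mg, P, Q` on the sheet — i.e. `(S_{ee}, S_{eν}) = (P, Q)`
there — and only `g` needs to be analytic along normal lines to conclude `g ≡ 0` (`eq_zero_on_tube_of_vanishesToOrder`). -/

/-- **CK RECURSION FOR THE MIXED SYSTEM** (`g` second order, `P, Q` first order in the normal direction): if vanishing of `g` to order `k+1` and of `P, Q` to order `k`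
forces vanishing of `∂_m²g`, `∂_mP`, `∂_mQ` to order `k`, and `g, ∂_mg, P, Q` vanish on the sheet, then the whole normal jets of `g, P, Q` vanish on the sheet. -/
theorem vanishesToOrder_all_of_mixedSystem {O : Set Y} {g P Q : Y × ℝ → ℝ}
    (hstep : ∀ k : ℕ, (∀ j ≤ (k + 1), ∀ y ∈ O, ((pd dN)^[j] g) (y, 0) = 0) → (∀ j ≤ k, ∀ y ∈ O, ((pd dN)^[j] P) (y, 0) = 0) →
      (∀ j ≤ k, ∀ y ∈ O, ((pd dN)^[j] Q) (y, 0) = 0) →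
      (∀ j ≤ k, ∀ y ∈ O, ((pd dN)^[j] (pd dN (pd dN g))) (y, 0) = 0) ∧ (∀ j ≤ k, ∀ y ∈ O, ((pd dN)^[j] (pd dN P)) (y, 0) = 0) ∧
        (∀ j ≤ k, ∀ y ∈ O, ((pd dN)^[j] (pd dN Q)) (y, 0) = 0))
    (hg0 : ∀ y ∈ O, g (y, 0) = 0) (hg1 : ∀ y ∈ O, pd dN g (y, 0) = 0) (hP0 : ∀ y ∈ O, P (y, 0) = 0) (hQ0 : ∀ y ∈ O, Q (y, 0) = 0) :
    ∀ k : ℕ, (∀ j ≤ k, ∀ y ∈ O, ((pd dN)^[j] g) (y, 0) = 0) ∧ (∀ j ≤ k, ∀ y ∈ O, ((pd dN)^[j] P) (y, 0) = 0) ∧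
      (∀ j ≤ k, ∀ y ∈ O, ((pd dN)^[j] Q) (y, 0) = 0) := by
  have hP : ∀ j ≤ 0, ∀ y ∈ O, ((pd dN)^[j] P) (y, 0) = 0 := by
    intro j hj y hy
    have hj0 : j = 0 := Nat.le_zero.1 hj
    subst hj0; simpa using hP0 y hy
  have hQ : ∀ j ≤ 0, ∀ y ∈ O, ((pd dN)^[j] Q) (y, 0) = 0 := by
    intro j hj y hy
    have hj0 : j = 0 := Nat.le_zero.1 hj
    subst hj0; simpa using hQ0 y hy
  have hg : ∀ j ≤ (0 + 1), ∀ y ∈ O, ((pd dN)^[j] g) (y, 0) = 0 := by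
    refine vanishesToOrder_succ_of_pdN hg0 ?_
    intro j hj y hy
    have hj0 : j = 0 := Nat.le_zero.1 hj
    subst hj0; simpa using hg1 y hy
  -- induction: (g to order k+1, P and Q to order k) ⇒ (g to order k+2, P and Q to order k+1)
  have key : ∀ k : ℕ, (∀ j ≤ (k + 1), ∀ y ∈ O, ((pd dN)^[j] g) (y, 0) = 0) ∧ (∀ j ≤ k, ∀ y ∈ O, ((pd dN)^[j] P) (y, 0) = 0) ∧
      (∀ j ≤ k, ∀ y ∈ O, ((pd dN)^[j] Q) (y, 0) = 0) := by
    intro k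
    induction k with
    | zero => exact ⟨hg, hP, hQ⟩
    | succ k ih =>
      obtain ⟨ihg, ihP, ihQ⟩ := ih
      obtain ⟨hg2, hP1, hQ1⟩ := hstep k ihg ihP ihQ
      exact ⟨vanishesToOrder_succ_of_pdN hg0 (vanishesToOrder_succ_of_pdN hg1 hg2), vanishesToOrder_succ_of_pdN hP0 hP1,
        vanishesToOrder_succ_of_pdN hQ0 hQ1⟩
  intro k
  exact ⟨vanishesToOrder_mono (key k).1 (Nat.le_succ k), (key k).2.1, (key k).2.2⟩

/-- **UNIQUENESS FOR THE MIXED SYSTEM**: under the recursion hypothesis of `vanishesToOrder_all_of_mixedSystem`, zero Cauchy data `g, ∂_mg, P, Q` on the sheet, `g` smooth on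
the tube and real-analytic along every normal line ⊢ `g ≡ 0` on the tube (the conclusion the case-I kill uses: `g = ∂_eU₂ ≡ 0`). -/
theorem eq_zero_on_tube_of_mixedSystem {O : Set Y} (hO : IsOpen O) {g P Q : Y × ℝ → ℝ} (hgs : ContDiffOn ℝ ∞ g (tube O))
    (hgan : ∀ y ∈ O, AnalyticOnNhd ℝ (fun r : ℝ => g (y, r)) univ)
    (hstep : ∀ k : ℕ, (∀ j ≤ (k + 1), ∀ y ∈ O, ((pd dN)^[j] g) (y, 0) = 0) → (∀ j ≤ k, ∀ y ∈ O, ((pd dN)^[j] P) (y, 0) = 0) →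
      (∀ j ≤ k, ∀ y ∈ O, ((pd dN)^[j] Q) (y, 0) = 0) →
      (∀ j ≤ k, ∀ y ∈ O, ((pd dN)^[j] (pd dN (pd dN g))) (y, 0) = 0) ∧ (∀ j ≤ k, ∀ y ∈ O, ((pd dN)^[j] (pd dN P)) (y, 0) = 0) ∧
        (∀ j ≤ k, ∀ y ∈ O, ((pd dN)^[j] (pd dN Q)) (y, 0) = 0))
    (hg0 : ∀ y ∈ O, g (y, 0) = 0) (hg1 : ∀ y ∈ O, pd dN g (y, 0) = 0) (hP0 : ∀ y ∈ O, P (y, 0) = 0) (hQ0 : ∀ y ∈ O, Q (y, 0) = 0)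
    {y : Y} (hy : y ∈ O) (m : ℝ) : g (y, m) = 0 :=
  eq_zero_on_tube_of_vanishesToOrder hO hgs hgan (fun k => (vanishesToOrder_all_of_mixedSystem hstep hg0 hg1 hP0 hQ0 k).1) hy m

/-! ### The template of the application: rows (curl), (div), (E3) with smooth coefficients ⇒ `g ≡ 0` -/

section Template

variable {O : Set Y} {g P Q : Y × ℝ → ℝ}

/-- Vanishing to order `k` is stable under multiplication by the constant `−1` (a convenience instance of `vanishesToOrder_mul`). -/
theorem vanishesToOrder_neg (hO : IsOpen O) {F : Y × ℝ → ℝ} (hF : ContDiffOn ℝ ∞ F (tube O)) {k : ℕ}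
    (h : ∀ j ≤ k, ∀ y ∈ O, ((pd dN)^[j] F) (y, 0) = 0) : ∀ j ≤ k, ∀ y ∈ O, ((pd dN)^[j] (fun q => (-1 : ℝ) * F q)) (y, 0) = 0 :=
  vanishesToOrder_mul hO k contDiffOn_const hF h

/-- **THE CASE-I TEMPLATE.**  Three smooth unknowns `g, P, Q` on the tube `O × ℝ` satisfying
(curl) `∂_mP = ∂_{w_s}Q`, (div) `∂_mQ = −∂_{w_s}P − (∂_{w_z}g − d_z·∂_mg)`, and
(E3)  `∂_m²g = α₁·∂_{w_s}²g + α₂·∂_{w_t}g + α₃·∂_{w_z}g + α₄·∂_{w_s}g + α₅·∂_mg + α₆·g + α₇·P + α₈·Q`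
with smooth coefficients (`w_s, w_t, w_z` any tangential directions), zero Cauchy data `g = ∂_mg = P = Q = 0` on the sheet, and `g` real-analytic along normal lines
⊢ `g ≡ 0` on the tube.  (In T2B-g17 §7: `g = ∂_eU₂`, `P = ⟪∂_eU_h,e⟫`, `Q = ⟪∂_eU_h,Je⟫` in sheared coordinates; (curl)/(div) = port-2 `…ShearedKinematics`, (E3) = p530500
pulled back; the data vanish by web criticality, the rank-one Hessian and `…SheetDataRigidity`.) -/
theorem eq_zero_of_mixedSystem_template (hO : IsOpen O) (hg : ContDiffOn ℝ ∞ g (tube O)) (hP : ContDiffOn ℝ ∞ P (tube O))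
    (hQ : ContDiffOn ℝ ∞ Q (tube O)) (hgan : ∀ y ∈ O, AnalyticOnNhd ℝ (fun r : ℝ => g (y, r)) univ)
    (wS wT wZ : Y) {dz α₁ α₂ α₃ α₄ α₅ α₆ α₇ α₈ : Y × ℝ → ℝ}
    (hdz : ContDiffOn ℝ ∞ dz (tube O)) (hα₁ : ContDiffOn ℝ ∞ α₁ (tube O)) (hα₂ : ContDiffOn ℝ ∞ α₂ (tube O))
    (hα₃ : ContDiffOn ℝ ∞ α₃ (tube O)) (hα₄ : ContDiffOn ℝ ∞ α₄ (tube O)) (hα₅ : ContDiffOn ℝ ∞ α₅ (tube O))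
    (hα₆ : ContDiffOn ℝ ∞ α₆ (tube O)) (hα₇ : ContDiffOn ℝ ∞ α₇ (tube O)) (hα₈ : ContDiffOn ℝ ∞ α₈ (tube O))
    (hR1 : ∀ p ∈ tube O, pd dN P p = pd (tg wS) Q p)
    (hR2 : ∀ p ∈ tube O, pd dN Q p = -pd (tg wS) P p - (pd (tg wZ) g p - dz p * pd dN g p))
    (hR3 : ∀ p ∈ tube O, pd dN (pd dN g) p =
      α₁ p * pd (tg wS) (pd (tg wS) g) p + α₂ p * pd (tg wT) g p + α₃ p * pd (tg wZ) g p + α₄ p * pd (tg wS) g p +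
        α₅ p * pd dN g p + α₆ p * g p + α₇ p * P p + α₈ p * Q p)
    (hg0 : ∀ y ∈ O, g (y, 0) = 0) (hg1 : ∀ y ∈ O, pd dN g (y, 0) = 0) (hP0 : ∀ y ∈ O, P (y, 0) = 0) (hQ0 : ∀ y ∈ O, Q (y, 0) = 0)
    {y : Y} (hy : y ∈ O) (m : ℝ) : g (y, m) = 0 := by
  -- smoothness of all the pieces
  have hgS := contDiffOn_pd hO hg (tg wS)
  have hgSS := contDiffOn_pd hO hgS (tg wS)
  have hgT := contDiffOn_pd hO hg (tg wT)
  have hgZ := contDiffOn_pd hO hg (tg wZ)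
  have hgN := contDiffOn_pd hO hg dN
  have hPS := contDiffOn_pd hO hP (tg wS)
  have hQS := contDiffOn_pd hO hQ (tg wS)
  refine eq_zero_on_tube_of_mixedSystem hO hg hgan ?_ hg0 hg1 hP0 hQ0 hy m
  intro k Vg VP VQ
  -- the ingredients at order `k`
  have Vg' : ∀ j ≤ k, ∀ y ∈ O, ((pd dN)^[j] g) (y, 0) = 0 := vanishesToOrder_mono Vg (Nat.le_succ k)
  have VgN : ∀ j ≤ k, ∀ y ∈ O, ((pd dN)^[j] (pd dN g)) (y, 0) = 0 := vanishesToOrder_pdN Vg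
  have VgS : ∀ j ≤ k, ∀ y ∈ O, ((pd dN)^[j] (pd (tg wS) g)) (y, 0) = 0 :=
    vanishesToOrder_mono (vanishesToOrder_pd_tangential hO hg Vg wS) (Nat.le_succ k)
  have VgSS : ∀ j ≤ k, ∀ y ∈ O, ((pd dN)^[j] (pd (tg wS) (pd (tg wS) g))) (y, 0) = 0 :=
    vanishesToOrder_mono (vanishesToOrder_pd_tangential hO hgS (vanishesToOrder_pd_tangential hO hg Vg wS) wS) (Nat.le_succ k)
  have VgT : ∀ j ≤ k, ∀ y ∈ O, ((pd dN)^[j] (pd (tg wT) g)) (y, 0) = 0 :=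
    vanishesToOrder_mono (vanishesToOrder_pd_tangential hO hg Vg wT) (Nat.le_succ k)
  have VgZ : ∀ j ≤ k, ∀ y ∈ O, ((pd dN)^[j] (pd (tg wZ) g)) (y, 0) = 0 :=
    vanishesToOrder_mono (vanishesToOrder_pd_tangential hO hg Vg wZ) (Nat.le_succ k)
  have VPS : ∀ j ≤ k, ∀ y ∈ O, ((pd dN)^[j] (pd (tg wS) P)) (y, 0) = 0 := vanishesToOrder_pd_tangential hO hP VP wS
  have VQS : ∀ j ≤ k, ∀ y ∈ O, ((pd dN)^[j] (pd (tg wS) Q)) (y, 0) = 0 := vanishesToOrder_pd_tangential hO hQ VQ wS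
  refine ⟨?_, ?_, ?_⟩
  · -- (E3)
    have h1 := vanishesToOrder_mul hO k hα₁ hgSS VgSS
    have h2 := vanishesToOrder_mul hO k hα₂ hgT VgT
    have h3 := vanishesToOrder_mul hO k hα₃ hgZ VgZ
    have h4 := vanishesToOrder_mul hO k hα₄ hgS VgS
    have h5 := vanishesToOrder_mul hO k hα₅ hgN VgN
    have h6 := vanishesToOrder_mul hO k hα₆ hg Vg'
    have h7 := vanishesToOrder_mul hO k hα₇ hP VP
    have h8 := vanishesToOrder_mul hO k hα₈ hQ VQ
    have s12 := vanishesToOrder_add hO (hα₁.mul hgSS) (hα₂.mul hgT) h1 h2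
    have s123 := vanishesToOrder_add hO ((hα₁.mul hgSS).add (hα₂.mul hgT)) (hα₃.mul hgZ) s12 h3
    have s1234 := vanishesToOrder_add hO (((hα₁.mul hgSS).add (hα₂.mul hgT)).add (hα₃.mul hgZ)) (hα₄.mul hgS) s123 h4
    have s5 := vanishesToOrder_add hO ((((hα₁.mul hgSS).add (hα₂.mul hgT)).add (hα₃.mul hgZ)).add (hα₄.mul hgS)) (hα₅.mul hgN) s1234 h5
    have s6 := vanishesToOrder_add hO (((((hα₁.mul hgSS).add (hα₂.mul hgT)).add (hα₃.mul hgZ)).add (hα₄.mul hgS)).add (hα₅.mul hgN))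
      (hα₆.mul hg) s5 h6
    have s7 := vanishesToOrder_add hO ((((((hα₁.mul hgSS).add (hα₂.mul hgT)).add (hα₃.mul hgZ)).add (hα₄.mul hgS)).add (hα₅.mul hgN)).add
      (hα₆.mul hg)) (hα₇.mul hP) s6 h7
    have s8 := vanishesToOrder_add hO (((((((hα₁.mul hgSS).add (hα₂.mul hgT)).add (hα₃.mul hgZ)).add (hα₄.mul hgS)).add (hα₅.mul hgN)).add
      (hα₆.mul hg)).add (hα₇.mul hP)) (hα₈.mul hQ) s7 h8
    refine vanishesToOrder_congr hO (fun p hp => ?_) s8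
    rw [hR3 p hp]
  · -- (curl)
    exact vanishesToOrder_congr hO (fun p hp => (hR1 p hp).symm) VQS
  · -- (div)
    have h1 := vanishesToOrder_neg hO hPS VPS
    have h2 := vanishesToOrder_neg hO hgZ VgZ
    have h3 := vanishesToOrder_mul hO k hdz hgN VgN
    have s12 := vanishesToOrder_add hO (contDiffOn_const.mul hPS) (contDiffOn_const.mul hgZ) h1 h2
    have s123 := vanishesToOrder_add hO ((contDiffOn_const.mul hPS).add (contDiffOn_const.mul hgZ)) (hdz.mul hgN) s12 h3
    refine vanishesToOrder_congr hO (fun p hp => ?_) s123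
    rw [hR2 p hp]
    ring

end Template

end Summit.NavierStokesRegularity.NavierStokesRegularity.Theorems.PoloidalWindowDoorLrcModEntireSheetSystemMixed

end
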